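import Mathlib
import Literature.Analysis.FluidPDE.MVRelativeEnergyPointwiseBounds

/-!
# The packing-order resolvent in the acoustic (inner) variables: normal form and coefficient bounds
# (crux `DenseExcursion`, stmt-AtomisticToContinuum-12586, line `sonic-cavity-renewal` v8, stub `stub_packingResolventW`)

Helper file (`--supports stmt-AtomisticToContinuum-12586`) for the registered stub `stub_packingResolventW` (skeleton v8)
of the line `sonic-cavity-renewal`: the PURE ALGEBRA and the PURE REAL ARITHMETIC of the inner (acoustic) region of the
barrier a-priori estimate behind the `(1 + S)`-weighted Laplace gain (registered helper `packingResolventW_innerCoeff`).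

**The inner variables.** Near the centre the real resolvent system `Λu − Lu = f` (`L = (linW, linS)`, real `Λ = kμ`
large, source `(f₁, f₂)`) is NOT a weakly coupled pair of transport equations (the acoustic layer at `R = eˣ ≍ s₀/Λ`,
wave-3 finding of this line), but in the variables `u₁` and `V := (Λ/s₀²)·e^{2x}·S·u₂` it is a regular `O(1/Λ)`
perturbation of the forced modified-spherical-Bessel system `u₁′ = −3u₁ + 3V − 3g`, `V′ = (ρ²/3)u₁`, `ρ = Λeˣ/s₀`,
`g = f₂/S`:

* `inner_normal_form` (Cramer, determinant `S² − (1 − W)²`, stated without division): the exact normal form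
  `u₁′ = a₁₁u₁ + a₁₂V + h₁`, `V′ = a₂₁u₁ + a₂₂V + h₂`, the six coefficients characterised by polynomial identities;
* `inner_a11_bound`, …, `inner_h2_bound`: on `x ≤ x_Λ = log(2s₀/Λ)`, `Λ ≥ 1000` (`δ = 1/Λ`), with the centre expansion of
  the cavity tube simplified by `inner_atoms_small` to the atoms `|W − (r−1)|, |W′|, |eˣS − s₀|, |(eˣS)′| ≤ δ²`,
  `7/10 ≤ eˣS ≤ 1`, `eˣ ≤ 2δ`: `|a₁₁ + 3| ≤ 8δ`, `|a₁₂ − 3| ≤ δ/10`, `|a₂₁ − ρ²/3| ≤ (2/3)ρ²δ`, `0 ≤ a₂₂ ≤ (9/10)ρ²δ`,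
  `|h₁| ≤ (301/100)N`, `|h₂| ≤ N(17ρ/50 + ρ²/100)` for sources with `|f₁| ≤ N(1 + S)`, `|f₂| ≤ NS`.

Elementary (ring identities and explicit inequalities); the wave-4 worker's numerics on `SS(r₂)` (`validate_barrier.py`:
`Λ|a₁₁ + 3| ≤ 3.55`, `Λ²|a₁₂ − 3| ≤ 9.0`, `Λ|a₂₁ − ρ²/3|/ρ² ≤ 0.591`, `Λa₂₂/ρ² ≤ 0.887`) sit inside the constants.
NOT here: any function, derivative or profile — only real numbers at one point `x ≤ x_Λ`.
-/

namespace Summit.AtomisticToContinuum.HydrodynamicLimit.Theorems.PackingAnalyticImplosion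

open Literature.Analysis.FluidPDE.CompressibleEuler (abs_mul_le_of_le)

/-! ## Arithmetic helpers -/

/-- `Λ ≥ 1000` from `δΛ = 1`, `0 < δ ≤ 1/1000`. [folklore] -/
theorem thousand_le_of_delta {Λ δ : ℝ} (hδΛ : δ * Λ = 1) (hδ : 0 < δ) (hδ' : δ ≤ 1 / 1000) : 1000 ≤ Λ := by
  rcases le_or_gt 0 Λ with h | h
  · have h1 : δ * Λ ≤ (1 / 1000) * Λ := mul_le_mul_of_nonneg_right hδ' h
    rw [hδΛ] at h1; linarith
  · have : δ * Λ < 0 := mul_neg_of_pos_of_neg hδ h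
    linarith

/-! ## The normal form in the inner variables (pure algebra) -/

/-- **THE RESOLVENT SYSTEM IN THE ACOUSTIC VARIABLES** (Cramer with determinant `S² − (1 − w)²`, no division): from the
two real resolvent equations at a point (`w = W(x)`, `w′ = W′(x)`, `S, S′`, unknowns `U₁, U₂` with derivatives `U₁′, U₂′`,
sources `F₁, F₂`, `e = eˣ`), the variable `V` with `s₀²V = Λe²SU₂` (so `s₀²V′ = Λ(2e²SU₂ + e²S′U₂ + e²SU₂′)`) and `U₁`
satisfy `U₁′ = a₁₁U₁ + a₁₂V + h₁`, `V′ = a₂₁U₁ + a₂₂V + h₂` for ANY reals `aᵢⱼ, hᵢ` obeying the six displayed polynomial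
characterisations (which determine them, the multipliers being non-zero). [folklore] -/
theorem inner_normal_form (Λ r w w' S S' U₁ U₁' U₂ U₂' F₁ F₂ e s₀ V V' a₁₁ a₁₂ a₂₁ a₂₂ h₁ h₂ : ℝ)
    (hS : S ≠ 0) (hDd : S ^ 2 - (1 - w) ^ 2 ≠ 0) (hs₀ : s₀ ≠ 0)
    (e1 : Λ * U₁ - ((w - 1) * U₁' + 3 * S * U₂' + (w' + 2 * w - r) * U₁ + (3 * S' + 6 * S) * U₂) = F₁)
    (e2 : Λ * U₂ - (S / 3 * U₁' + (w - 1) * U₂' + (S' + 2 * S) * U₁ + (w' / 3 + 2 * w - r) * U₂) = F₂)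
    (hV : s₀ ^ 2 * V = Λ * e ^ 2 * S * U₂)
    (hV' : s₀ ^ 2 * V' = Λ * (2 * e ^ 2 * S * U₂ + e ^ 2 * S' * U₂ + e ^ 2 * S * U₂'))
    (ha11 : a₁₁ * (S ^ 2 - (1 - w) ^ 2) = -3 * (2 * S + S') * S + (1 - w) * (Λ - (w' + 2 * w - r)))
    (ha12 : a₁₂ * (Λ * e ^ 2 * S * (S ^ 2 - (1 - w) ^ 2)) =
      3 * s₀ ^ 2 * (Λ * S + (w - 1) * (2 * S + S') - (w' / 3 + 2 * w - r) * S))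
    (ha21 : a₂₁ * (s₀ ^ 2 * (S ^ 2 - (1 - w) ^ 2)) =
      Λ * e ^ 2 * S * (Λ * S / 3 - (w' + 2 * w - r) * S / 3 - (1 - w) * (2 * S + S')))
    (ha22 : a₂₂ * ((S ^ 2 - (1 - w) ^ 2) * S) = (1 - w) * (Λ * S + (w - 1) * (2 * S + S') - (w' / 3 + 2 * w - r) * S))
    (hh1 : h₁ * (S ^ 2 - (1 - w) ^ 2) = -(3 * S * F₂ + (1 - w) * F₁))
    (hh2 : h₂ * (s₀ ^ 2 * (S ^ 2 - (1 - w) ^ 2)) = -(Λ * e ^ 2 * S * ((1 - w) * F₂ + S * F₁ / 3))) :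
    U₁' = a₁₁ * U₁ + a₁₂ * V + h₁ ∧ V' = a₂₁ * U₁ + a₂₂ * V + h₂ := by
  have c1 : (S ^ 2 - (1 - w) ^ 2) * U₁' = (1 - w) * (Λ * U₁ - (w' + 2 * w - r) * U₁ - (3 * S' + 6 * S) * U₂ - F₁)
      + 3 * S * (Λ * U₂ - (S' + 2 * S) * U₁ - (w' / 3 + 2 * w - r) * U₂ - F₂) := by
    linear_combination (-(1 - w)) * e1 - 3 * S * e2
  have c2 : (S ^ 2 - (1 - w) ^ 2) * U₂' = S / 3 * (Λ * U₁ - (w' + 2 * w - r) * U₁ - (3 * S' + 6 * S) * U₂ - F₁)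
      + (1 - w) * (Λ * U₂ - (S' + 2 * S) * U₁ - (w' / 3 + 2 * w - r) * U₂ - F₂) := by
    linear_combination (-(S / 3)) * e1 - (1 - w) * e2
  have hs2 : s₀ ^ 2 ≠ 0 := pow_ne_zero 2 hs₀
  constructor
  · have hK : s₀ ^ 2 * (S ^ 2 - (1 - w) ^ 2) ≠ 0 := mul_ne_zero hs2 hDd
    apply mul_left_cancel₀ hK
    linear_combination (s₀ ^ 2) * c1 - (s₀ ^ 2 * U₁) * ha11 - (s₀ ^ 2) * hh1
      - (a₁₂ * (S ^ 2 - (1 - w) ^ 2)) * hV - U₂ * ha12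
  · have hK : s₀ ^ 2 * (S ^ 2 - (1 - w) ^ 2) * S ≠ 0 := mul_ne_zero (mul_ne_zero hs2 hDd) hS
    apply mul_left_cancel₀ hK
    linear_combination ((S ^ 2 - (1 - w) ^ 2) * S) * hV' + (Λ * e ^ 2 * S ^ 2) * c2 - (S * U₁) * ha21
      - (a₂₂ * (S ^ 2 - (1 - w) ^ 2) * S) * hV - (Λ * e ^ 2 * S * U₂) * ha22 - S * hh2

/-! ## The atoms on `x ≤ x_Λ` -/

/-- SIMPLIFIED ATOMS on `x ≤ x_Λ = log(2s₀/Λ)`, `Λ ≥ 1000` (`δ = 1/Λ`, `e = eˣ ≤ 2s₀/Λ`): `e ≤ 2δ`, and the two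
centre-expansion remainders `e²/10 + 2e⁴`, `e²/5 + 2e⁴` of the cavity tube are `≤ δ²`. [folklore] -/
theorem inner_atoms_small {Λ δ e s₀ : ℝ} (hδΛ : δ * Λ = 1) (hδ : 0 < δ) (hδ' : δ ≤ 1 / 1000) (he : 0 < e)
    (heΛ : e * Λ ≤ 2 * s₀) (hs₀' : s₀ ≤ 1) :
    e ≤ 2 * δ ∧ e ^ 2 / 10 + 2 * e ^ 4 ≤ δ ^ 2 ∧ e ^ 2 / 5 + 2 * e ^ 4 ≤ δ ^ 2 := by
  have hΛ : 1000 ≤ Λ := thousand_le_of_delta hδΛ hδ hδ'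
  have he2 : e ≤ 2 * δ := by
    have h1 : e * Λ ≤ 2 := by linarith
    have h2 : e * Λ * δ ≤ 2 * δ := mul_le_mul_of_nonneg_right h1 hδ.le
    calc e = e * (δ * Λ) := by rw [hδΛ, mul_one]
      _ = e * Λ * δ := by ring
      _ ≤ 2 * δ := h2
  have hE : e ^ 2 ≤ 4 * δ ^ 2 := by
    calc e ^ 2 ≤ (2 * δ) ^ 2 := pow_le_pow_left₀ he.le he2 2
      _ = 4 * δ ^ 2 := by ring
  have hδ2 : δ ^ 2 ≤ 1 / 1000000 := by
    calc δ ^ 2 ≤ (1 / 1000) ^ 2 := pow_le_pow_left₀ hδ.le hδ' 2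
      _ = 1 / 1000000 := by norm_num
  have hE2 : e ^ 4 ≤ 16 * δ ^ 2 * δ ^ 2 := by
    calc e ^ 4 = (e ^ 2) ^ 2 := by ring
      _ ≤ (4 * δ ^ 2) ^ 2 := pow_le_pow_left₀ (by positivity) hE 2
      _ = 16 * δ ^ 2 * δ ^ 2 := by ring
  have hE3 : 16 * δ ^ 2 * δ ^ 2 ≤ 16 * δ ^ 2 * (1 / 1000000) := mul_le_mul_of_nonneg_left hδ2 (by positivity)
  have hδp : 0 < δ ^ 2 := pow_pos hδ 2
  refine ⟨he2, by linarith, by linarith⟩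

/-- COMMON CONSEQUENCES of the simplified atoms used by every coefficient bound: `δ² ≤ δ/1000`, `e² ≤ 4δ²`,
`0.88 ≤ 1 − w ≤ 0.8924`, `(1−w)²e² ≤ 4δ²`, and the reduced determinant `s̃² − (1−w)²e² ∈ [0.48, 1]` (`s̃ = eˣS`).
[folklore] -/
theorem inner_basic {δ r w e S : ℝ} (hδ : 0 < δ) (hδ' : δ ≤ 1 / 1000) (he : 0 < e) (he2 : e ≤ 2 * δ)
    (hst1 : 7 / 10 ≤ S * e) (hst2 : S * e ≤ 1) (hw : |w - (r - 1)| ≤ δ ^ 2)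
    (hr1 : 17307 / 15625 ≤ r) (hr2 : r ≤ 697 / 625) :
    δ ^ 2 ≤ δ / 1000 ∧ e ^ 2 ≤ 4 * δ ^ 2 ∧ (88 / 100 ≤ 1 - w ∧ 1 - w ≤ 8924 / 10000) ∧
      (1 - w) ^ 2 * e ^ 2 ≤ 4 * δ ^ 2 ∧ 48 / 100 ≤ (S * e) ^ 2 - (1 - w) ^ 2 * e ^ 2 ∧
      (S * e) ^ 2 - (1 - w) ^ 2 * e ^ 2 ≤ 1 := by
  have hδ2 : δ ^ 2 ≤ δ / 1000 := by
    calc δ ^ 2 = δ * δ := sq δ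
      _ ≤ δ * (1 / 1000) := mul_le_mul_of_nonneg_left hδ' hδ.le
      _ = δ / 1000 := by ring
  have hE : e ^ 2 ≤ 4 * δ ^ 2 := by
    calc e ^ 2 ≤ (2 * δ) ^ 2 := pow_le_pow_left₀ he.le he2 2
      _ = 4 * δ ^ 2 := by ring
  obtain ⟨hwl, hwu⟩ := abs_le.1 hw
  have hw1 : 88 / 100 ≤ 1 - w := by linarith
  have hw2 : 1 - w ≤ 8924 / 10000 := by linarith
  have hww : (1 - w) ^ 2 ≤ 1 := by
    calc (1 - w) ^ 2 ≤ 1 ^ 2 := pow_le_pow_left₀ (by linarith) (by linarith) 2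
      _ = 1 := by ring
  have hwe : (1 - w) ^ 2 * e ^ 2 ≤ 4 * δ ^ 2 := by
    calc (1 - w) ^ 2 * e ^ 2 ≤ 1 * (4 * δ ^ 2) := mul_le_mul hww hE (by positivity) (by norm_num)
      _ = 4 * δ ^ 2 := by ring
  have hst : 49 / 100 ≤ (S * e) ^ 2 := by
    calc (49 / 100 : ℝ) = (7 / 10) ^ 2 := by norm_num
      _ ≤ (S * e) ^ 2 := pow_le_pow_left₀ (by norm_num) hst1 2
  have hst' : (S * e) ^ 2 ≤ 1 := by
    calc (S * e) ^ 2 ≤ 1 ^ 2 := pow_le_pow_left₀ (by linarith) hst2 2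
      _ = 1 := by ring
  refine ⟨hδ2, hE, ⟨hw1, hw2⟩, hwe, by linarith, ?_⟩
  linarith [sq_nonneg ((1 - w) * e), show (1 - w) ^ 2 * e ^ 2 = ((1 - w) * e) ^ 2 by ring]

/-- `|a₁₁ + 3| ≤ 8δ`: `(a₁₁ + 3)(s̃² − (1−w)²e²) = −3s̃·(eˣS)′ − 3(1−w)²e² + (1−w)(Λ − b₁)e²`, `s̃ = eˣS`, `Λe² ≤ 4δ`. [folklore] -/
theorem inner_a11_bound {Λ δ r w w' S S' e a₁₁ : ℝ} (hδΛ : δ * Λ = 1) (hδ : 0 < δ) (hδ' : δ ≤ 1 / 1000)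
    (he : 0 < e) (he2 : e ≤ 2 * δ) (hst1 : 7 / 10 ≤ S * e) (hst2 : S * e ≤ 1)
    (hsd : |e * (S + S')| ≤ δ ^ 2) (hw : |w - (r - 1)| ≤ δ ^ 2) (hw' : |w'| ≤ δ ^ 2)
    (hr1 : 17307 / 15625 ≤ r) (hr2 : r ≤ 697 / 625)
    (ha11 : a₁₁ * (S ^ 2 - (1 - w) ^ 2) = -3 * (2 * S + S') * S + (1 - w) * (Λ - (w' + 2 * w - r))) :
    |a₁₁ + 3| ≤ 8 * δ := by
  obtain ⟨hδ2, hE, ⟨hw1, hw2⟩, hwe, hP, -⟩ := inner_basic hδ hδ' he he2 hst1 hst2 hw hr1 hr2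
  obtain ⟨hwl, hwu⟩ := abs_le.1 hw
  obtain ⟨hw'l, hw'u⟩ := abs_le.1 hw'
  have hΛ : 1000 ≤ Λ := by
    have h1 : δ * Λ ≤ (1 / 1000) * Λ ∨ Λ < 0 := by
      rcases le_or_gt 0 Λ with h | h
      · exact Or.inl (mul_le_mul_of_nonneg_right hδ' h)
      · exact Or.inr h
    rcases h1 with h1 | h1
    · rw [hδΛ] at h1; linarith
    · nlinarith
  have hΛE : Λ * e ^ 2 ≤ 4 * δ := by
    calc Λ * e ^ 2 ≤ Λ * (4 * δ ^ 2) := mul_le_mul_of_nonneg_left hE (by linarith)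
      _ = 4 * δ * (δ * Λ) := by ring
      _ = 4 * δ := by rw [hδΛ, mul_one]
  have key : (a₁₁ + 3) * ((S * e) ^ 2 - (1 - w) ^ 2 * e ^ 2) =
      -3 * (S * e) * (e * (S + S')) + -(3 * ((1 - w) ^ 2 * e ^ 2)) + (1 - w) * ((Λ - (w' + 2 * w - r)) * e ^ 2) := by
    linear_combination e ^ 2 * ha11
  have t1 : |(-3 * (S * e)) * (e * (S + S'))| ≤ 3 * δ ^ 2 :=
    abs_mul_le_of_le (by rw [abs_le]; constructor <;> linarith) hsd
  have t2 : |(-(3 * ((1 - w) ^ 2 * e ^ 2)))| ≤ 3 * (4 * δ ^ 2) := by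
    rw [abs_neg, abs_of_nonneg (by positivity)]; linarith
  have t3 : |(1 - w) * ((Λ - (w' + 2 * w - r)) * e ^ 2)| ≤ 9 / 10 * (4 * δ + 4 * δ ^ 2) := by
    refine abs_mul_le_of_le (by rw [abs_le]; constructor <;> linarith) ?_
    rw [abs_mul, abs_of_nonneg (by positivity : (0:ℝ) ≤ e ^ 2)]
    have h1 : |Λ - (w' + 2 * w - r)| ≤ Λ + 1 := by rw [abs_le]; constructor <;> linarith
    calc |Λ - (w' + 2 * w - r)| * e ^ 2 ≤ (Λ + 1) * e ^ 2 := mul_le_mul_of_nonneg_right h1 (by positivity)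
      _ = Λ * e ^ 2 + e ^ 2 := by ring
      _ ≤ 4 * δ + 4 * δ ^ 2 := by linarith
  have hnum : |(a₁₁ + 3) * ((S * e) ^ 2 - (1 - w) ^ 2 * e ^ 2)| ≤ 362 / 100 * δ := by
    rw [key]
    refine (abs_add_three _ _ _).trans ?_
    linarith
  rw [abs_mul, abs_of_pos (by linarith : (0:ℝ) < (S * e) ^ 2 - (1 - w) ^ 2 * e ^ 2)] at hnum
  have h1 : |a₁₁ + 3| * (48 / 100) ≤ 362 / 100 * δ :=
    (mul_le_mul_of_nonneg_left hP (abs_nonneg _)).trans hnum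
  linarith


/-- `|a₁₂ − 3| ≤ δ/10`: `(a₁₂ − 3)Λs̃(s̃² − (1−w)²e²) = 3Λs̃(s₀² − s̃² + (1−w)²e²) + 3s₀²(s̃((r−1−w) − w′/3) + (w−1)(eˣS)′)`
(the combination `(w − 1) − b₂ = (r − 1 − w) − w′/3` is second order). [folklore] -/
theorem inner_a12_bound {Λ δ r w w' S S' e s₀ a₁₂ : ℝ} (hδΛ : δ * Λ = 1) (hδ : 0 < δ) (hδ' : δ ≤ 1 / 1000)
    (he : 0 < e) (he2 : e ≤ 2 * δ) (hs₀ : 7 / 10 ≤ s₀) (hs₀' : s₀ ≤ 1) (hst1 : 7 / 10 ≤ S * e) (hst2 : S * e ≤ 1)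
    (hst0 : |S * e - s₀| ≤ δ ^ 2) (hsd : |e * (S + S')| ≤ δ ^ 2) (hw : |w - (r - 1)| ≤ δ ^ 2) (hw' : |w'| ≤ δ ^ 2)
    (hr1 : 17307 / 15625 ≤ r) (hr2 : r ≤ 697 / 625)
    (ha12 : a₁₂ * (Λ * e ^ 2 * S * (S ^ 2 - (1 - w) ^ 2)) =
      3 * s₀ ^ 2 * (Λ * S + (w - 1) * (2 * S + S') - (w' / 3 + 2 * w - r) * S)) :
    |a₁₂ - 3| ≤ δ / 10 := by
  obtain ⟨hδ2, hE, ⟨hw1, hw2⟩, hwe, hP, -⟩ := inner_basic hδ hδ' he he2 hst1 hst2 hw hr1 hr2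
  obtain ⟨hwl, hwu⟩ := abs_le.1 hw
  obtain ⟨hw'l, hw'u⟩ := abs_le.1 hw'
  have hΛ : 1000 ≤ Λ := thousand_le_of_delta hδΛ hδ hδ'
  set P : ℝ := (S * e) ^ 2 - (1 - w) ^ 2 * e ^ 2 with hP_def
  have key : (a₁₂ - 3) * (Λ * (S * e) * P) =
      3 * Λ * (S * e) * ((s₀ - S * e) * (s₀ + S * e) + (1 - w) ^ 2 * e ^ 2) +
        3 * s₀ ^ 2 * ((S * e) * ((r - 1 - w) - w' / 3) + (w - 1) * (e * (S + S'))) + 0 := by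
    rw [hP_def]; linear_combination e * ha12
  have t1 : |3 * Λ * (S * e) * ((s₀ - S * e) * (s₀ + S * e) + (1 - w) ^ 2 * e ^ 2)| ≤ 3 * Λ * (6 * δ ^ 2) := by
    rw [abs_mul, abs_of_nonneg (by positivity : (0:ℝ) ≤ 3 * Λ * (S * e))]
    have h2 : |(s₀ - S * e) * (s₀ + S * e)| ≤ δ ^ 2 * 2 :=
      abs_mul_le_of_le (by rw [abs_sub_comm]; exact hst0) (by rw [abs_le]; constructor <;> linarith)
    have h3 : |(s₀ - S * e) * (s₀ + S * e) + (1 - w) ^ 2 * e ^ 2| ≤ 6 * δ ^ 2 := by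
      calc _ ≤ |(s₀ - S * e) * (s₀ + S * e)| + |(1 - w) ^ 2 * e ^ 2| := abs_add_le _ _
        _ ≤ δ ^ 2 * 2 + 4 * δ ^ 2 := add_le_add h2 (by rw [abs_of_nonneg (by positivity)]; exact hwe)
        _ = 6 * δ ^ 2 := by ring
    calc 3 * Λ * (S * e) * |(s₀ - S * e) * (s₀ + S * e) + (1 - w) ^ 2 * e ^ 2|
        ≤ 3 * Λ * 1 * (6 * δ ^ 2) :=
          mul_le_mul (mul_le_mul_of_nonneg_left hst2 (by positivity)) h3 (abs_nonneg _) (by positivity)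
      _ = 3 * Λ * (6 * δ ^ 2) := by ring
  have t2 : |3 * s₀ ^ 2 * ((S * e) * ((r - 1 - w) - w' / 3) + (w - 1) * (e * (S + S')))| ≤ 3 * (3 * δ ^ 2) := by
    rw [abs_mul, abs_of_nonneg (by positivity : (0:ℝ) ≤ 3 * s₀ ^ 2)]
    have h2 : |(S * e) * ((r - 1 - w) - w' / 3)| ≤ 1 * (2 * δ ^ 2) :=
      abs_mul_le_of_le (by rw [abs_le]; constructor <;> linarith) (by rw [abs_le]; constructor <;> linarith)
    have h3 : |(w - 1) * (e * (S + S'))| ≤ 1 * δ ^ 2 :=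
      abs_mul_le_of_le (by rw [abs_le]; constructor <;> linarith) hsd
    have h4 : |(S * e) * ((r - 1 - w) - w' / 3) + (w - 1) * (e * (S + S'))| ≤ 3 * δ ^ 2 := by
      calc _ ≤ |(S * e) * ((r - 1 - w) - w' / 3)| + |(w - 1) * (e * (S + S'))| := abs_add_le _ _
        _ ≤ 3 * δ ^ 2 := by linarith
    have hs2 : s₀ ^ 2 ≤ 1 := by
      calc s₀ ^ 2 ≤ 1 ^ 2 := pow_le_pow_left₀ (by linarith) hs₀' 2
        _ = 1 := by ring
    calc 3 * s₀ ^ 2 * |(S * e) * ((r - 1 - w) - w' / 3) + (w - 1) * (e * (S + S'))| ≤ 3 * 1 * (3 * δ ^ 2) :=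
          mul_le_mul (by linarith) h4 (abs_nonneg _) (by norm_num)
      _ = 3 * (3 * δ ^ 2) := by ring
  have hnum : |(a₁₂ - 3) * (Λ * (S * e) * P)| ≤ 18 * Λ * δ ^ 2 + 9 * δ ^ 2 := by
    rw [key]
    refine (abs_add_three _ _ _).trans ?_
    rw [abs_zero]; linarith
  have hden : 336 / 1000 * Λ ≤ Λ * (S * e) * P := by
    have h1 : Λ * (7 / 10) ≤ Λ * (S * e) := mul_le_mul_of_nonneg_left hst1 (by linarith)
    calc 336 / 1000 * Λ = Λ * (7 / 10) * (48 / 100) := by ring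
      _ ≤ Λ * (S * e) * P := mul_le_mul h1 hP (by norm_num) (by positivity)
  have hdpos : 0 < Λ * (S * e) * P := by positivity
  rw [abs_mul, abs_of_pos hdpos] at hnum
  have h1 : |a₁₂ - 3| * (336 / 1000 * Λ) ≤ 18 * Λ * δ ^ 2 + 9 * δ ^ 2 :=
    (mul_le_mul_of_nonneg_left hden (abs_nonneg _)).trans hnum
  -- multiply by `δ` and use `δΛ = 1`
  have h3 : |a₁₂ - 3| * (336 / 1000 * Λ) * δ ≤ (18 * Λ * δ ^ 2 + 9 * δ ^ 2) * δ :=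
    mul_le_mul_of_nonneg_right h1 hδ.le
  have e1 : |a₁₂ - 3| * (336 / 1000 * Λ) * δ = |a₁₂ - 3| * (336 / 1000) * (δ * Λ) := by ring
  have e2 : (18 * Λ * δ ^ 2 + 9 * δ ^ 2) * δ = 18 * δ * δ * (δ * Λ) + 9 * δ ^ 2 * δ := by ring
  rw [e1, e2, hδΛ, mul_one, mul_one] at h3
  have h4 : 18 * δ * δ + 9 * δ ^ 2 * δ ≤ 336 / 10000 * δ := by
    have h5 : δ * δ ≤ δ / 1000 := by rw [← sq]; exact hδ2
    have h6 : δ ^ 2 * δ ≤ δ / 1000 * δ := mul_le_mul_of_nonneg_right hδ2 hδ.le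
    have h7 : δ / 1000 * δ ≤ δ / 1000 * (1 / 1000) := mul_le_mul_of_nonneg_left hδ' (by positivity)
    linarith
  have h8 : |a₁₂ - 3| * (336 / 1000) ≤ 336 / 10000 * δ := h3.trans h4
  linarith


/-- **Registered helper `packingResolventW_innerNormalForm` of `stub_packingResolventW`** (= `inner_normal_form` in the
registered `∀`-form): the real resolvent system at a point, rewritten WITHOUT LOSS in the acoustic variables
`(U₁, V)`, `s₀²V = Λe²SU₂`. [folklore] -/
theorem packingResolventW_innerNormalForm : ∀ (Λ r w w' S S' U₁ U₁' U₂ U₂' F₁ F₂ e s₀ V V' a₁₁ a₁₂ a₂₁ a₂₂ h₁ h₂ : ℝ), S ≠ 0 → S ^ 2 - (1 - w) ^ 2 ≠ 0 → s₀ ≠ 0 → Λ * U₁ - ((w - 1) * U₁' + 3 * S * U₂' + (w' + 2 * w - r) * U₁ + (3 * S' + 6 * S) * U₂) = F₁ → Λ * U₂ - (S / 3 * U₁' + (w - 1) * U₂' + (S' + 2 * S) * U₁ + (w' / 3 + 2 * w - r) * U₂) = F₂ → s₀ ^ 2 * V = Λ * e ^ 2 * S * U₂ → s₀ ^ 2 *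 V' = Λ * (2 * e ^ 2 * S * U₂ + e ^ 2 * S' * U₂ + e ^ 2 * S * U₂') → a₁₁ * (S ^ 2 - (1 - w) ^ 2) = -3 * (2 * S + S') * S + (1 - w) * (Λ - (w' + 2 * w - r)) → a₁₂ * (Λ * e ^ 2 * S * (S ^ 2 - (1 - w) ^ 2)) = 3 * s₀ ^ 2 * (Λ * S + (w - 1) * (2 * S + S') - (w' / 3 + 2 * w - r) * S) → a₂₁ * (s₀ ^ 2 * (S ^ 2 - (1 - w) ^ 2)) = Λ * e ^ 2 * S * (Λ * S / 3 - (w' + 2 * w - r) * S / 3 - (1 - w) * (2 * S + S')) → a₂₂ * ((S ^ 2 - (1 - w) ^ 2) * S) = (1 - w) * (Λ * S + (w - 1) * (2 * S + S') - (w' / 3 + 2 * w - r) * S) → h₁ * (S ^ 2 - (1 - w) ^ 2) = -(3 * S * F₂ + (1 - w) * F₁) → h₂ * (s₀ ^ 2 * (S ^ 2 - (1 - w) ^ 2)) = -(Λ * e ^ 2 * S * ((1 - w) * F₂ + S * F₁ / 3)) → U₁' = a₁₁ * U₁ + a₁₂ * V + h₁ ∧ V' = a₂₁ * U₁ + a₂₂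 * V + h₂ := by
  intro Λ r w w' S S' U₁ U₁' U₂ U₂' F₁ F₂ e s₀ V V' a₁₁ a₁₂ a₂₁ a₂₂ h₁ h₂ hS hDd hs₀ e1 e2 hV hV' ha11 ha12 ha21 ha22 hh1 hh2
  exact inner_normal_form Λ r w w' S S' U₁ U₁' U₂ U₂' F₁ F₂ e s₀ V V' a₁₁ a₁₂ a₂₁ a₂₂ h₁ h₂ hS hDd hs₀ e1 e2 hV hV' ha11
    ha12 ha21 ha22 hh1 hh2

end Summit.AtomisticToContinuum.HydrodynamicLimit.Theorems.PackingAnalyticImplosion
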